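import Mathlib
import HarnessLib
import Summits.Ventures.LatticeQCDFlow.Exactness.PopulationLeaveOneOutExact
import Summits.Ventures.LatticeQCDFlow.Exactness.SelfTunedFlowChoiceBias

/-!
# LatticeQCDFlow / Exactness — LEARNING ON THE JOB, III: MOVING ALL WALKERS AT ONCE, EACH FROM A FLOW FITTED TO THE OTHERS' CURRENT
# STATES, IS NOT EXACT — unless the information flows one way (two-walker witness `1/4 ↦ 37/144`; the one-directional update is a
# sequential sweep in disguise)

HONEST FRAMING: exact (Metropolis-corrected) sampling algorithms for lattice gauge theory;
figures of merit are autocorrelation/cost numbers at stated couplings and volumes; no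
continuum-physics claim.

Venture `LatticeQCDFlow` (cell pub-lqcd), topic `Exactness`, FANOUT row 30 (lean-1 GEN-44, theme LEARNING ON THE JOB).  The cautionary
twin of `PopulationLeaveOneOutExact`.  NEW WORK of the cell; no definition is introduced, nothing is cited as a fact.  Tree inputs:
`PopulationLeaveOneOutExact` (`leaveOneOut_fst_invariant`, `leaveOneOut_snd_invariant`, `leaveOneOut_sequential_invariant`),
`IMHKernel`, the `Bool` bookkeeping of `IMHNaiveRetryBias` ∕ `SelfTunedFlowChoiceBias` (`NaiveRetryWitness.*`, `SelfTunedWitness.*`).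
Printed counterparts NAMED ONLY: the two-half ("parallel stretch move") rule of ensemble samplers, stated there precisely because the
all-at-once update is invalid (Goodman–Weare 2010; Foreman-Mackey et al. 2013 §"parallelization").

## Setting
As in `PopulationLeaveOneOutExact`: blocks `Ω` (target `π`) and `Ω'` (target `π'`), a walker update `κ : Kernel (Ω' × Ω) Ω` reading the
rest and a rest update `κ' : Kernel (Ω × Ω') Ω'` reading the walker, every frozen section exact.  THE SIMULTANEOUS UPDATE: from `(x, x')`
both blocks move at once and independently, the walker by `κ(x', x)`, the rest by `κ'(x, x')` — DEF-FREE, `U` is any kernel on `Ω × Ω'`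
with `U(x, x') = κ(x', x) ⊗ κ'(x, x')` (hypothesis `hU`; for the witness only its values on rectangles are used).

## Results (no `sorry`)
* §1 ONE-DIRECTIONAL INFORMATION FLOW IS EXACT EVEN SIMULTANEOUSLY (`simultaneous_oneWay_eq_comp`, **`simultaneous_oneWay_invariant`**):
  if the rest does not read the walker (`κ'(x, x') = K'(x')`, `K'` exact for `π'`), the simultaneous kernel EQUALS the sequential sweep
  "walker first (reading the rest), then the rest by `K'`", hence leaves `π ⊗ π'` invariant.  Reading: a walker may be proposed from a
  flow fitted to the CURRENT states of reference walkers that evolve on their own (exactly, never reading it), all in the same step.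
* §2 THE TWO-WALKER WITNESS (`Bool × Bool`, both walkers with target `π = w·q`, `q` uniform, `w = (1, 2)`): each walker uses the
  PERFECT-flow sampler `P₁` when the other walker sits at `true` and the uniform-flow sampler `P₀ = indepMH q w` when it sits at `false`
  (both exact: `SelfTunedWitness.perfect_invariant` ∕ `uniform_invariant`; every frozen section exact); both move at once:
  **`simultaneous_bind_apply_ff`** — EVERY kernel realising the simultaneous rule moves `(π ⊗ π)({(false, false)}) = 1/4` to `37/144`;
  **`simultaneous_not_invariant`**.  `simultaneous_witness_sequential_invariant` — the SAME two walkers updated one after the other ARE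
  exact (`PopulationLeaveOneOutExact`).
Reading (gauge files): a GPU-friendly "update every walker in parallel from the flow fitted to all the others" is biased; split the
population in two halves and alternate (each half is one block of `PopulationLeaveOneOutExact`), or let the training set be walkers that
never read the ones they train.
-/

namespace Summit.Ventures.LatticeQCDFlow.Exactness

open MeasureTheory ProbabilityTheory
open scoped ENNReal

variable {Ω Ω' : Type*} [MeasurableSpace Ω] [MeasurableSpace Ω'] {π : Measure Ω} {π' : Measure Ω'}

/-! ## §1 One-directional information flow: the simultaneous update is a sequential sweep in disguise -/

/-- The walker half-sweep as a push-forward: `T₁(x, x') = κ(x', x).map (y ↦ (y, x'))`. [ours, bookkeeping] -/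
theorem leaveOneOut_fst_eq_map (κ : Kernel (Ω' × Ω) Ω) (T₁ : Kernel (Ω × Ω') (Ω × Ω'))
    (hT₁ : ∀ (x : Ω) (x' : Ω') {C : Set (Ω × Ω')}, MeasurableSet C → T₁ (x, x') C = κ (x', x) ((fun y => (y, x')) ⁻¹' C))
    (x : Ω) (x' : Ω') : T₁ (x, x') = (κ (x', x)).map fun y => (y, x') := by
  ext C hC
  rw [hT₁ x x' hC, Measure.map_apply measurable_prodMk_right hC]

/-- **ONE-WAY SIMULTANEOUS = SEQUENTIAL**: if the rest's update does not read the walker (`κ'(x, x') = K'(x')`), the simultaneous kernel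
`U(x, x') = κ(x', x) ⊗ K'(x')` coincides with the sweep `T₂ ∘ₖ T₁` (walker first reading the rest, then the rest by `K'`). [ours] -/
theorem simultaneous_oneWay_eq_comp (κ : Kernel (Ω' × Ω) Ω) [IsMarkovKernel κ] (K' : Kernel Ω' Ω') [IsMarkovKernel K']
    (T₁ T₂ U : Kernel (Ω × Ω') (Ω × Ω'))
    (hT₁ : ∀ (x : Ω) (x' : Ω') {C : Set (Ω × Ω')}, MeasurableSet C → T₁ (x, x') C = κ (x', x) ((fun y => (y, x')) ⁻¹' C))
    (hT₂ : ∀ (x : Ω) (x' : Ω') {C : Set (Ω × Ω')}, MeasurableSet C → T₂ (x, x') C = K' x' ((fun y' => (x, y')) ⁻¹' C))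
    (hU : ∀ (x : Ω) (x' : Ω') {C : Set (Ω × Ω')}, MeasurableSet C → U (x, x') C = ((κ (x', x)).prod (K' x')) C) :
    U = T₂ ∘ₖ T₁ := by
  ext p C hC
  obtain ⟨x, x'⟩ := p
  rw [hU x x' hC, Kernel.comp_apply' _ _ _ hC, leaveOneOut_fst_eq_map κ T₁ hT₁ x x',
    lintegral_map (Kernel.measurable_coe T₂ hC) measurable_prodMk_right, Measure.prod_apply hC]
  refine lintegral_congr fun y => ?_
  rw [hT₂ y x' hC]

/-- **ONE-DIRECTIONAL INFORMATION FLOW IS EXACT EVEN SIMULTANEOUSLY**: the walker proposed from a kernel fitted to the rest's CURRENT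
state, the rest moving AT THE SAME TIME by an exact kernel that does not read the walker: `π ⊗ π'` is invariant. [ours] -/
theorem simultaneous_oneWay_invariant [SFinite π] [SFinite π'] (κ : Kernel (Ω' × Ω) Ω) [IsMarkovKernel κ]
    (hκ : ∀ (x' : Ω') {B : Set Ω}, MeasurableSet B → ∫⁻ x, κ (x', x) B ∂π = π B) (K' : Kernel Ω' Ω') [IsMarkovKernel K']
    (hK' : Kernel.Invariant K' π') (T₁ T₂ U : Kernel (Ω × Ω') (Ω × Ω'))
    (hT₁ : ∀ (x : Ω) (x' : Ω') {C : Set (Ω × Ω')}, MeasurableSet C → T₁ (x, x') C = κ (x', x) ((fun y => (y, x')) ⁻¹' C))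
    (hT₂ : ∀ (x : Ω) (x' : Ω') {C : Set (Ω × Ω')}, MeasurableSet C → T₂ (x, x') C = K' x' ((fun y' => (x, y')) ⁻¹' C))
    (hU : ∀ (x : Ω) (x' : Ω') {C : Set (Ω × Ω')}, MeasurableSet C → U (x, x') C = ((κ (x', x)).prod (K' x')) C) :
    Kernel.Invariant U (π.prod π') := by
  rw [simultaneous_oneWay_eq_comp κ K' T₁ T₂ U hT₁ hT₂ hU]
  refine (leaveOneOut_snd_invariant (Kernel.prodMkLeft Ω K') (fun x B' hB' => ?_) T₂ (fun x x' C hC => ?_)).comp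
    (leaveOneOut_fst_invariant κ hκ T₁ hT₁)
  · simp_rw [Kernel.prodMkLeft_apply]
    exact lintegral_apply_eq_of_invariant K' hK' hB'
  · rw [hT₂ x x' hC, Kernel.prodMkLeft_apply]

/-- The sweep kernels of §1 exist (so the hypotheses `hT₁`, `hT₂` can always be met). [ours, bookkeeping] -/
theorem leaveOneOut_snd_exists (K' : Kernel Ω' Ω') [IsMarkovKernel K'] :
    ∃ T₂ : Kernel (Ω × Ω') (Ω × Ω'), ∀ (x : Ω) (x' : Ω') {C : Set (Ω × Ω')}, MeasurableSet C →
      T₂ (x, x') C = K' x' ((fun y' => (x, y')) ⁻¹' C) := by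
  refine ⟨(Kernel.deterministic Prod.fst measurable_fst) ×ₖ (K'.comap Prod.snd measurable_snd), fun x x' C hC => ?_⟩
  rw [Kernel.prod_apply' _ _ _ hC, Kernel.comap_apply, Kernel.deterministic_apply]
  show ∫⁻ b, K' x' (Prod.mk b ⁻¹' C) ∂Measure.dirac x = _
  rw [lintegral_dirac' _ (measurable_measure_prodMk_left hC)]

/-! ## §2 The two-walker witness: both read each other, both move at once -/

section SimultaneousWitness

variable {q q₁ : Measure Bool} {w : Bool → ℝ}

/-- **THE WITNESS, QUANTIFIED**: two walkers on `Bool`, each with target `π = w·q` (`q` uniform, `w = (1, 2)`: `π({false}) = 1/2`,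
`π({true}) = 1`); each uses the perfect-flow sampler `P₁` if the OTHER walker is at `true` and the uniform-flow sampler `P₀` otherwise; both
move at once, independently given the current pair.  For EVERY kernel realising this: `((π ⊗ π)U)({(false, false)}) = 37/144`, against
`(π ⊗ π)({(false, false)}) = 1/4 = 36/144`. [ours] -/
theorem simultaneous_bind_apply_ff (hq : ∀ b, q {b} = ENNReal.ofReal 2⁻¹) (hwf : w false = 1) (hwt : w true = 2)
    (hq₁f : q₁ {false} = ENNReal.ofReal 3⁻¹) [IsProbabilityMeasure q₁] (P₀ P₁ : Kernel Bool Bool)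
    (hP₀ : ∀ (x : Bool) {B : Set Bool}, MeasurableSet B → P₀ x B =
      ∫⁻ y in B, imhAcceptE w x y ∂q + (1 - imhAcceptMass q w x) * B.indicator 1 x)
    (hP₁ : ∀ (x : Bool) {B : Set Bool}, MeasurableSet B → P₁ x B =
      ∫⁻ y in B, imhAcceptE (fun _ : Bool => (3 / 2 : ℝ)) x y ∂q₁ + (1 - imhAcceptMass q₁ (fun _ : Bool => (3 / 2 : ℝ)) x) * B.indicator 1 x)
    (κ : Kernel (Bool × Bool) Bool)
    (hκf : ∀ (x : Bool) {B : Set Bool}, MeasurableSet B → κ (false, x) B = P₀ x B)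
    (hκt : ∀ (x : Bool) {B : Set Bool}, MeasurableSet B → κ (true, x) B = P₁ x B)
    (U : Kernel (Bool × Bool) (Bool × Bool))
    (hU : ∀ (x x' : Bool) (B B' : Set Bool), MeasurableSet B → MeasurableSet B' →
      U (x, x') (B ×ˢ B') = κ (x', x) B * κ (x, x') B') :
    (((q.withDensity fun y => ENNReal.ofReal (w y)).prod (q.withDensity fun y => ENNReal.ofReal (w y))).bind U)
        {(false, false)} = ENNReal.ofReal (37 / 144) := by
  obtain ⟨hπf, hπt⟩ := NaiveRetryWitness.target_eq hq hwf hwt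
  set π₂ : Measure Bool := q.withDensity fun y => ENNReal.ofReal (w y) with hπ₂
  obtain ⟨h0f, h0t⟩ := SelfTunedWitness.uniform_apply_false hq hwf hwt P₀ hP₀
  have h1 : ∀ x, P₁ x {false} = ENNReal.ofReal 3⁻¹ := SelfTunedWitness.perfect_apply_false hq₁f P₁ hP₁
  have hs : MeasurableSet ({false} : Set Bool) := measurableSet_singleton _
  have hrect : ({(false, false)} : Set (Bool × Bool)) = {false} ×ˢ {false} := by
    rw [Set.singleton_prod_singleton]
  -- the four one-step probabilities of landing on `(false, false)`
  have hUff : U (false, false) {(false, false)} = ENNReal.ofReal 4⁻¹ := by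
    rw [hrect, hU _ _ _ _ hs hs, hκf _ hs, h0f, ← ENNReal.ofReal_mul (by norm_num)]; norm_num
  have hUft : U (false, true) {(false, false)} = ENNReal.ofReal 12⁻¹ := by
    rw [hrect, hU _ _ _ _ hs hs, hκt _ hs, hκf _ hs, h1, h0t, ← ENNReal.ofReal_mul (by norm_num)]; norm_num
  have hUtf : U (true, false) {(false, false)} = ENNReal.ofReal 12⁻¹ := by
    rw [hrect, hU _ _ _ _ hs hs, hκf _ hs, hκt _ hs, h0t, h1, ← ENNReal.ofReal_mul (by norm_num)]; norm_num
  have hUtt : U (true, true) {(false, false)} = ENNReal.ofReal 9⁻¹ := by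
    rw [hrect, hU _ _ _ _ hs hs, hκt _ hs, h1, ← ENNReal.ofReal_mul (by norm_num)]; norm_num
  -- the four masses of the product target
  have hππ : ∀ x x' : Bool, (π₂.prod π₂) {(x, x')} = π₂ {x} * π₂ {x'} := fun x x' => by
    rw [← Set.singleton_prod_singleton, Measure.prod_prod]
  have hmff : (π₂.prod π₂) {(false, false)} = ENNReal.ofReal 4⁻¹ := by
    rw [hππ, hπf, ← ENNReal.ofReal_mul (by norm_num)]; norm_num
  have hmft : (π₂.prod π₂) {(false, true)} = ENNReal.ofReal 2⁻¹ := by rw [hππ, hπf, hπt, mul_one]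
  have hmtf : (π₂.prod π₂) {(true, false)} = ENNReal.ofReal 2⁻¹ := by rw [hππ, hπf, hπt, one_mul]
  have hmtt : (π₂.prod π₂) {(true, true)} = 1 := by rw [hππ, hπt, mul_one]
  rw [Measure.bind_apply (measurableSet_singleton _) (Kernel.aemeasurable _), lintegral_fintype, Fintype.sum_prod_type]
  simp only [Fintype.sum_bool, hUff, hUft, hUtf, hUtt, hmff, hmft, hmtf, hmtt, mul_one]
  rw [← ENNReal.ofReal_mul (by norm_num), ← ENNReal.ofReal_mul (by norm_num),
    ← ENNReal.ofReal_add (by norm_num) (by norm_num), ← ENNReal.ofReal_add (by norm_num) (by norm_num),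
    ← ENNReal.ofReal_add (by norm_num) (by norm_num)]
  norm_num

/-- **MOVING BOTH WALKERS AT ONCE IS NOT EXACT**: for EVERY kernel realising the simultaneous mutual-reading rule of the witness,
`π ⊗ π` is NOT invariant. [ours] -/
theorem simultaneous_not_invariant (hq : ∀ b, q {b} = ENNReal.ofReal 2⁻¹) (hwf : w false = 1) (hwt : w true = 2)
    (hq₁f : q₁ {false} = ENNReal.ofReal 3⁻¹) [IsProbabilityMeasure q₁] (P₀ P₁ : Kernel Bool Bool)
    (hP₀ : ∀ (x : Bool) {B : Set Bool}, MeasurableSet B → P₀ x B =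
      ∫⁻ y in B, imhAcceptE w x y ∂q + (1 - imhAcceptMass q w x) * B.indicator 1 x)
    (hP₁ : ∀ (x : Bool) {B : Set Bool}, MeasurableSet B → P₁ x B =
      ∫⁻ y in B, imhAcceptE (fun _ : Bool => (3 / 2 : ℝ)) x y ∂q₁ + (1 - imhAcceptMass q₁ (fun _ : Bool => (3 / 2 : ℝ)) x) * B.indicator 1 x)
    (κ : Kernel (Bool × Bool) Bool)
    (hκf : ∀ (x : Bool) {B : Set Bool}, MeasurableSet B → κ (false, x) B = P₀ x B)
    (hκt : ∀ (x : Bool) {B : Set Bool}, MeasurableSet B → κ (true, x) B = P₁ x B)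
    (U : Kernel (Bool × Bool) (Bool × Bool))
    (hU : ∀ (x x' : Bool) (B B' : Set Bool), MeasurableSet B → MeasurableSet B' →
      U (x, x') (B ×ˢ B') = κ (x', x) B * κ (x, x') B') :
    ¬ Kernel.Invariant U
      ((q.withDensity fun y => ENNReal.ofReal (w y)).prod (q.withDensity fun y => ENNReal.ofReal (w y))) := by
  intro h
  obtain ⟨hπf, -⟩ := NaiveRetryWitness.target_eq hq hwf hwt
  have h1 := congrArg (fun μ : Measure (Bool × Bool) => μ {(false, false)}) h.def
  rw [simultaneous_bind_apply_ff hq hwf hwt hq₁f P₀ P₁ hP₀ hP₁ κ hκf hκt U hU, ← Set.singleton_prod_singleton,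
    Measure.prod_prod, hπf, ← ENNReal.ofReal_mul (by norm_num), ENNReal.ofReal_eq_ofReal_iff (by norm_num) (by norm_num)] at h1
  norm_num at h1

/-- **… WHILE THE SAME TWO WALKERS UPDATED ONE AFTER THE OTHER ARE EXACT**: every frozen section of the witness's `κ` is exact (from
`false` it is `P₀`, from `true` it is `P₁`, both exact), so the sequential sweep leaves `π ⊗ π` invariant (`PopulationLeaveOneOutExact`).
[ours] -/
theorem simultaneous_witness_sequential_invariant [IsProbabilityMeasure q] (hq : ∀ b, q {b} = ENNReal.ofReal 2⁻¹)
    (hwf : w false = 1) (hwt : w true = 2) (hq₁f : q₁ {false} = ENNReal.ofReal 3⁻¹) (hq₁t : q₁ {true} = ENNReal.ofReal (2 / 3))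
    [IsProbabilityMeasure q₁] (P₀ P₁ : Kernel Bool Bool)
    (hP₀ : ∀ (x : Bool) {B : Set Bool}, MeasurableSet B → P₀ x B =
      ∫⁻ y in B, imhAcceptE w x y ∂q + (1 - imhAcceptMass q w x) * B.indicator 1 x)
    (hP₁ : ∀ (x : Bool) {B : Set Bool}, MeasurableSet B → P₁ x B =
      ∫⁻ y in B, imhAcceptE (fun _ : Bool => (3 / 2 : ℝ)) x y ∂q₁ + (1 - imhAcceptMass q₁ (fun _ : Bool => (3 / 2 : ℝ)) x) * B.indicator 1 x)
    (κ : Kernel (Bool × Bool) Bool)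
    (hκf : ∀ (x : Bool) {B : Set Bool}, MeasurableSet B → κ (false, x) B = P₀ x B)
    (hκt : ∀ (x : Bool) {B : Set Bool}, MeasurableSet B → κ (true, x) B = P₁ x B)
    (T₁ T₂ : Kernel (Bool × Bool) (Bool × Bool))
    (hT₁ : ∀ (x x' : Bool) {C : Set (Bool × Bool)}, MeasurableSet C → T₁ (x, x') C = κ (x', x) ((fun y => (y, x')) ⁻¹' C))
    (hT₂ : ∀ (x x' : Bool) {C : Set (Bool × Bool)}, MeasurableSet C → T₂ (x, x') C = κ (x, x') ((fun y' => (x, y')) ⁻¹' C)) :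
    Kernel.Invariant (T₂ ∘ₖ T₁)
      ((q.withDensity fun y => ENNReal.ofReal (w y)).prod (q.withDensity fun y => ENNReal.ofReal (w y))) := by
  have hI₀ := SelfTunedWitness.uniform_invariant (q := q) hwf hwt P₀ hP₀
  have hI₁ := SelfTunedWitness.perfect_invariant hq hwf hwt hq₁f hq₁t P₁ hP₁
  -- every frozen section of `κ` is exact
  have hsec : ∀ (x' : Bool) {B : Set Bool}, MeasurableSet B →
      ∫⁻ x, κ (x', x) B ∂(q.withDensity fun y => ENNReal.ofReal (w y)) = (q.withDensity fun y => ENNReal.ofReal (w y)) B := by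
    intro x' B hB
    cases x'
    · simp_rw [hκf _ hB]; exact lintegral_apply_eq_of_invariant P₀ hI₀ hB
    · simp_rw [hκt _ hB]; exact lintegral_apply_eq_of_invariant P₁ hI₁ hB
  exact leaveOneOut_sequential_invariant κ κ hsec hsec T₁ T₂ hT₁ hT₂

end SimultaneousWitness

end Summit.Ventures.LatticeQCDFlow.Exactness
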